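import Literature.NumberTheory.EllipticCurves.IwasawaAlgebra
import Summits.BirchSwinnertonDyer.BirchSwinnertonDyer.Theorems.UniversalToricDescentInvariantsTransportNormProfileFrames
import HarnessLib

/-!
# `Λ`-algebra endgame of an Euler-system road to `μ = 0`: an INTEGRAL inclusion by a `μ = 0` series pins a
# `μ = 0` generator of `Ch_Λ(X)·R₀⟦T⟧`

Pure algebra for the crux idea `inert-beilinson-flach-road` on `TwinAlgMuZeroAtThree` (stmt-BirchSwinnertonDyer-24254;
card `Cruxes/TwinAlgMuZeroAtThree/Ideas/inert-beilinson-flach-road.md`, Prop A2 = `IntegralInclusionGivesUnitGenerator`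
of `Cruxes/TwinAlgMuZeroAtThree/SketchUtdIdeaG52.lean`): if the characteristic ideal of a `Λ = ℤ_p⟦T⟧`-module `X`,
pushed to `R₀⟦T⟧`, CONTAINS a power series `F` with a coefficient of norm `1` (an Euler-system divisibility
`char X ∣ F` with `μ(F) = 0`), then `Ch_Λ(X)·R₀⟦T⟧ = (g)` for a `g` with a coefficient of norm `1` (`μ(X) = 0` in the
route's currency). Proof: `Ch_Λ(X)` is principal (`charIdeal_isPrincipal_holds`: `Λ` is a UFD), its image is generated
by the image `g` of a generator, `g ∣ F`, and a divisor of a series with a unit coefficient has a unit coefficient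
(ultrametric inequality, `norm_coeff_mul_lt_one_of_lt`, inlined). No torsion or finiteness hypothesis is needed; the VERBATIM
shape of A2 (which carries both) is `integralInclusionGivesUnitGenerator`. THEOREMS ONLY; no `sorry`, no named fact.
References: Washington, GTM 83, §13.2; folklore.
-/

set_option linter.dupNamespace false
set_option autoImplicit false

noncomputable section

open scoped Classical

namespace Summit.BirchSwinnertonDyer.BirchSwinnertonDyer.Theorems.UniversalToricDescentIntegralInclusionUnitGenerator

open Literature.NumberTheory.EllipticCurves Literature.NumberTheory.EllipticCurves.IwasawaAlgebra
  Summit.BirchSwinnertonDyer.Rank1Residual.X11b.Halves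
  Summit.BirchSwinnertonDyer.BirchSwinnertonDyer.Theorems.UniversalToricDescentNormProfile

variable {p : ℕ} [Fact p.Prime]

/-- **Integral inclusion by a `μ = 0` series ⇒ `μ = 0` generator.** For ANY `Λ`-module `X`: if
`F ∈ Ch_Λ(X)·R₀⟦T⟧` has a coefficient of norm `1`, then `Ch_Λ(X)·R₀⟦T⟧ = (g)` with `g` having a coefficient of
norm `1`. [folklore] -/
theorem exists_generator_norm_coeff_eq_one_of_mem (X : Type*) [AddCommGroup X] [Module (IwasawaAlgebra p) X]
    {F : UnrSeries p}
    (hmem : F ∈ (Module.charIdeal (IwasawaAlgebra p) X).map (PowerSeries.map (toUnr p)))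
    (hF : ∃ i : ℕ, ‖((PowerSeries.coeff i F : unrIntegers p) : ℂ_[p])‖ = 1) :
    ∃ g : UnrSeries p,
      (Module.charIdeal (IwasawaAlgebra p) X).map (PowerSeries.map (toUnr p)) = Ideal.span {g} ∧
        ∃ i : ℕ, ‖((PowerSeries.coeff i g : unrIntegers p) : ℂ_[p])‖ = 1 := by
  obtain ⟨G, hG⟩ := (charIdeal_isPrincipal_holds p X).principal
  have hchar : Module.charIdeal (IwasawaAlgebra p) X = Ideal.span {G} := hG
  have hmap : (Module.charIdeal (IwasawaAlgebra p) X).map (PowerSeries.map (toUnr p)) =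
      Ideal.span {PowerSeries.map (toUnr p) G} := by
    rw [hchar, Ideal.map_span, Set.image_singleton]
  refine ⟨PowerSeries.map (toUnr p) G, hmap, ?_⟩
  rw [hmap, Ideal.mem_span_singleton] at hmem
  -- a divisor of a series with a norm-one coefficient has a norm-one coefficient (ultrametric inequality;
  -- the argument of `…TwinAlgMu.exists_norm_coeff_eq_one_of_dvd`, utd-p1-w2 g6, route-independent here)
  obtain ⟨k, hk⟩ := hF
  by_contra hne
  have hlt : ∀ i, ‖((PowerSeries.coeff i (PowerSeries.map (toUnr p) G) : unrIntegers p) : ℂ_[p])‖ < 1 :=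
    fun i ↦ lt_of_le_of_ne (norm_coeff_le_one _ i) (fun h ↦ hne ⟨i, h⟩)
  obtain ⟨q, rfl⟩ := hmem
  have h := norm_coeff_mul_lt_one_of_lt q (n := k + 1) (fun i _ ↦ hlt i) k (Nat.lt_succ_self k)
  rw [mul_comm] at h
  exact absurd hk (ne_of_lt h)

/-- **`IntegralInclusionGivesUnitGenerator` at `p = 3`, VERBATIM shape** (crux idea `inert-beilinson-flach-road` on
stmt-BirchSwinnertonDyer-24254, Prop A2 of `SketchUtdIdeaG52.lean`; the finiteness and torsion hypotheses are idle). [folklore] -/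
theorem integralInclusionGivesUnitGenerator :
    ∀ (X : Type) [AddCommGroup X] [Module (IwasawaAlgebra 3) X] [Module.Finite (IwasawaAlgebra 3) X],
      Module.IsTorsion (IwasawaAlgebra 3) X →
      (∃ F : UnrSeries 3,
        F ∈ (Module.charIdeal (IwasawaAlgebra 3) X).map (PowerSeries.map (toUnr 3)) ∧
          ∃ i : ℕ, ‖((PowerSeries.coeff i F : unrIntegers 3) : ℂ_[3])‖ = 1) →
      ∃ g : UnrSeries 3,
        (Module.charIdeal (IwasawaAlgebra 3) X).map (PowerSeries.map (toUnr 3)) = Ideal.span {g} ∧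
          ∃ i : ℕ, ‖((PowerSeries.coeff i g : unrIntegers 3) : ℂ_[3])‖ = 1 := by
  intro X _ _ _ _ hF
  obtain ⟨F, hmem, hF⟩ := hF
  exact exists_generator_norm_coeff_eq_one_of_mem X hmem hF

end Summit.BirchSwinnertonDyer.BirchSwinnertonDyer.Theorems.UniversalToricDescentIntegralInclusionUnitGenerator

end
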